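import Mathlib
import Summits.ValiantsHypothesis.ValiantsHypothesis.Theorems.KPlusLogSqLawStepCross

/-!
# Binding events of a stepping row in lub/glb form; the FIVE-ROW SIGN LAW V, abstract core

Cell pub-symmetroid, seat conjb-2 (g22). A helper toward the crux `TropicalB`
(`Summit.ValiantsHypothesis.ValiantsHypothesis.Theses.KPlusLogSqLaw.TropicalB`, item
`stmt-ValiantsHypothesis-19771`); it earns no crux credit and is not evidence for `MatrixDescartes` or for
Valiant's hypothesis. Setting as in `KPlusLogSqLawStepSupStructure` / `KPlusLogSqLawStepCross`.

THE FIVE-ROW SIGN LAW V (THEORY-NOTE-g22 §4bis; row distance 4 in the event-pair family; a pure sign law on two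
lines, no partner; located as the k = 5 residue at reach 5, where it accounts for 10 471 of the 11 289 order types
killed beyond the earlier laws, and proved for every odd reach). Rows `i` and `i+4` step (each in either
direction), rows `i+1, i+2, i+3` move to the right, odd `d`, line `i` upper ⇒ `s (i+4) < s (i+d+1)`. PROOF: the
ENTERING line `i+d+1` of row `i` is the bottom upper line of `[i+1, i+d+1] ∋ i+4` at its binding point `A`
(`entering_event_right/left` — obtained from `step_sup_structure` by the index swap `t ↦ (2j+d+1) - t`, which
exchanges the two windows of a row, composed with `θ ↦ -θ` when needed; no new supremum argument), the LEAVING line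
`i+4` is the bottom upper line of `[i+4, i+d+4] ∋ i+d+1` at its binding point `B` (`leaving_event_right/left`), and
`A < B` because points of `T[i+2,·]` and `T[i+3,·]` lie between; `two_point_sign` finishes (`five_row_core`, stated
over four abstract predicates). The parity statements are in `KPlusLogSqLawStepFive`.
-/

set_option linter.dupNamespace false

namespace Summit.ValiantsHypothesis.ValiantsHypothesis.Theorems.KPlusLogSqLawStepEvents

open Summit.ValiantsHypothesis.ValiantsHypothesis.Theorems.KPlusLogSqLawStepSupStructure (step_sup_structure)
open Summit.ValiantsHypothesis.ValiantsHypothesis.Theorems.KPlusLogSqLawStepCross (two_point_sign)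

/-- Reflection `θ ↦ -θ` (slopes negated), class-generic. -/
theorem sep_grefl (up : ℕ → Prop) (s b : ℕ → ℝ) (lo hi : ℕ) (θ : ℝ)
    (h : ∀ e o : ℕ, lo ≤ e → e ≤ hi → lo ≤ o → o ≤ hi → up e → ¬ up o → b o + s o * θ < b e + s e * θ) :
    ∀ e o : ℕ, lo ≤ e → e ≤ hi → lo ≤ o → o ≤ hi → up e → ¬ up o → b o + -s o * -θ < b e + -s e * -θ := by
  intro e o h1 h2 h3 h4 he ho
  have := h e o h1 h2 h3 h4 he ho
  have r1 : -s o * -θ = s o * θ := by ring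
  have r2 : -s e * -θ = s e * θ := by ring
  linarith

/-- Inverse direction of `sep_grefl`. -/
theorem sep_of_grefl (up : ℕ → Prop) (s b : ℕ → ℝ) (lo hi : ℕ) (θ : ℝ)
    (h : ∀ e o : ℕ, lo ≤ e → e ≤ hi → lo ≤ o → o ≤ hi → up e → ¬ up o → b o + -s o * θ < b e + -s e * θ) :
    ∀ e o : ℕ, lo ≤ e → e ≤ hi → lo ≤ o → o ≤ hi → up e → ¬ up o → b o + s o * -θ < b e + s e * -θ := by
  intro e o h1 h2 h3 h4 he ho
  have := h e o h1 h2 h3 h4 he ho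
  have r1 : s o * -θ = -s o * θ := by ring
  have r2 : s e * -θ = -s e * θ := by ring
  linarith

/-- Index swap `t ↦ M - t` (window `[lo, hi] ↦ [lo', hi']`), class-generic. -/
theorem sep_swap (up : ℕ → Prop) (s b : ℕ → ℝ) (M lo hi lo' hi' : ℕ) (hM : lo' + hi = M) (hM' : lo + hi' = M)
    (θ : ℝ)
    (h : ∀ e o : ℕ, lo ≤ e → e ≤ hi → lo ≤ o → o ≤ hi → up e → ¬ up o → b o + s o * θ < b e + s e * θ) :
    ∀ e o : ℕ, lo' ≤ e → e ≤ hi' → lo' ≤ o → o ≤ hi' → up (M - e) → ¬ up (M - o) →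
      b (M - o) + s (M - o) * θ < b (M - e) + s (M - e) * θ := by
  intro e o h1 h2 h3 h4 he ho
  exact h (M - e) (M - o) (by omega) (by omega) (by omega) (by omega) he ho

/-- Inverse direction of `sep_swap`. -/
theorem sep_of_swap (up : ℕ → Prop) (s b : ℕ → ℝ) (M lo hi lo' hi' : ℕ) (hM : lo' + hi = M) (hM' : lo + hi' = M)
    (θ : ℝ)
    (h : ∀ e o : ℕ, lo' ≤ e → e ≤ hi' → lo' ≤ o → o ≤ hi' → up (M - e) → ¬ up (M - o) →
      b (M - o) + s (M - o) * θ < b (M - e) + s (M - e) * θ) :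
    ∀ e o : ℕ, lo ≤ e → e ≤ hi → lo ≤ o → o ≤ hi → up e → ¬ up o → b o + s o * θ < b e + s e * θ := by
  intro e o h1 h2 h3 h4 he ho
  have h5 : M - (M - e) = e := by omega
  have h6 : M - (M - o) = o := by omega
  have := h (M - e) (M - o) (by omega) (by omega) (by omega) (by omega) (by rw [h5]; exact he)
    (by rw [h6]; exact ho)
  rw [h5, h6] at this
  exact this

/-- Index swap composed with the reflection `θ ↦ -θ` (slopes negated), class-generic. -/
theorem sep_swaprefl (up : ℕ → Prop) (s b : ℕ → ℝ) (M lo hi lo' hi' : ℕ) (hM : lo' + hi = M)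
    (hM' : lo + hi' = M) (θ : ℝ)
    (h : ∀ e o : ℕ, lo ≤ e → e ≤ hi → lo ≤ o → o ≤ hi → up e → ¬ up o → b o + s o * θ < b e + s e * θ) :
    ∀ e o : ℕ, lo' ≤ e → e ≤ hi' → lo' ≤ o → o ≤ hi' → up (M - e) → ¬ up (M - o) →
      b (M - o) + -s (M - o) * -θ < b (M - e) + -s (M - e) * -θ := by
  intro e o h1 h2 h3 h4 he ho
  have := h (M - e) (M - o) (by omega) (by omega) (by omega) (by omega) he ho
  have r1 : -s (M - o) * -θ = s (M - o) * θ := by ring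
  have r2 : -s (M - e) * -θ = s (M - e) * θ := by ring
  linarith

/-- Inverse direction of `sep_swaprefl`. -/
theorem sep_of_swaprefl (up : ℕ → Prop) (s b : ℕ → ℝ) (M lo hi lo' hi' : ℕ) (hM : lo' + hi = M)
    (hM' : lo + hi' = M) (θ : ℝ)
    (h : ∀ e o : ℕ, lo' ≤ e → e ≤ hi' → lo' ≤ o → o ≤ hi' → up (M - e) → ¬ up (M - o) →
      b (M - o) + -s (M - o) * θ < b (M - e) + -s (M - e) * θ) :
    ∀ e o : ℕ, lo ≤ e → e ≤ hi → lo ≤ o → o ≤ hi → up e → ¬ up o → b o + s o * -θ < b e + s e * -θ := by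
  intro e o h1 h2 h3 h4 he ho
  have h5 : M - (M - e) = e := by omega
  have h6 : M - (M - o) = o := by omega
  have := h (M - e) (M - o) (by omega) (by omega) (by omega) (by omega) (by rw [h5]; exact he)
    (by rw [h6]; exact ho)
  rw [h5, h6] at this
  have r1 : s o * -θ = -s o * θ := by ring
  have r2 : s e * -θ = -s e * θ := by ring
  linarith

/-- Binding event of the (upper) LEAVING line, row moving RIGHT, in glb form: at `B = sup T[j, j+d]` the line `j` is
the bottom upper line of `[j, j+d]`, and every strict lower bound of `T[j, j+d]` is `≤ B`. -/
theorem leaving_event_right (up : ℕ → Prop) (s b : ℕ → ℝ) (j d : ℕ) (hup0 : up j) (hup1 : up (j + d + 1))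
    (hlow : ∃ o : ℕ, j + 1 ≤ o ∧ o ≤ j + d ∧ ¬ up o)
    (hA : ∃ θ : ℝ, ∀ e o : ℕ, j ≤ e → e ≤ j + d → j ≤ o → o ≤ j + d → up e → ¬ up o →
      b o + s o * θ < b e + s e * θ)
    (hB : ∃ θ : ℝ, ∀ e o : ℕ, j + 1 ≤ e → e ≤ j + d + 1 → j + 1 ≤ o → o ≤ j + d + 1 → up e → ¬ up o →
      b o + s o * θ < b e + s e * θ)
    (hord : ∀ θ θ' : ℝ, (∀ e o : ℕ, j ≤ e → e ≤ j + d → j ≤ o → o ≤ j + d → up e → ¬ up o →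
      b o + s o * θ < b e + s e * θ) → (∀ e o : ℕ, j + 1 ≤ e → e ≤ j + d + 1 → j + 1 ≤ o → o ≤ j + d + 1 →
      up e → ¬ up o → b o + s o * θ' < b e + s e * θ') → θ < θ') :
    ∃ B : ℝ, (∀ m : ℝ, (∀ θ : ℝ, (∀ e o : ℕ, j ≤ e → e ≤ j + d → j ≤ o → o ≤ j + d → up e → ¬ up o →
      b o + s o * θ < b e + s e * θ) → m < θ) → m ≤ B) ∧
      (∀ e : ℕ, j ≤ e → e ≤ j + d → up e → b j + s j * B ≤ b e + s e * B) := by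
  obtain ⟨θA, hθA⟩ := hA
  obtain ⟨r, q, hq1, hq2, hqc, -, -, heq, hcmp, hTle, -, -⟩ :=
    step_sup_structure up s b j d hup0 hup1 hlow ⟨θA, hθA⟩ hB (fun θ h => lt_irrefl θ (hord θ θ h.1 h.2)) hord
  refine ⟨r, fun m hm => ?_, fun e he1 he2 hec => ?_⟩
  · have h1 := hm θA hθA
    have h2 := hTle θA hθA
    linarith
  · have h1 := hcmp e q he1 he2 (by omega) hq2 hec hqc
    linarith

/-- Binding event of the (upper) LEAVING line, row moving LEFT (`B = inf T[j, j+d]`), same conclusion. -/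
theorem leaving_event_left (up : ℕ → Prop) (s b : ℕ → ℝ) (j d : ℕ) (hup0 : up j) (hup1 : up (j + d + 1))
    (hlow : ∃ o : ℕ, j + 1 ≤ o ∧ o ≤ j + d ∧ ¬ up o)
    (hA : ∃ θ : ℝ, ∀ e o : ℕ, j ≤ e → e ≤ j + d → j ≤ o → o ≤ j + d → up e → ¬ up o →
      b o + s o * θ < b e + s e * θ)
    (hB : ∃ θ : ℝ, ∀ e o : ℕ, j + 1 ≤ e → e ≤ j + d + 1 → j + 1 ≤ o → o ≤ j + d + 1 → up e → ¬ up o →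
      b o + s o * θ < b e + s e * θ)
    (hord : ∀ θ θ' : ℝ, (∀ e o : ℕ, j ≤ e → e ≤ j + d → j ≤ o → o ≤ j + d → up e → ¬ up o →
      b o + s o * θ < b e + s e * θ) → (∀ e o : ℕ, j + 1 ≤ e → e ≤ j + d + 1 → j + 1 ≤ o → o ≤ j + d + 1 →
      up e → ¬ up o → b o + s o * θ' < b e + s e * θ') → θ' < θ) :
    ∃ B : ℝ, (∀ m : ℝ, (∀ θ : ℝ, (∀ e o : ℕ, j ≤ e → e ≤ j + d → j ≤ o → o ≤ j + d → up e → ¬ up o →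
      b o + s o * θ < b e + s e * θ) → m < θ) → m ≤ B) ∧
      (∀ e : ℕ, j ≤ e → e ≤ j + d → up e → b j + s j * B ≤ b e + s e * B) := by
  obtain ⟨θA, hθA⟩ := hA
  obtain ⟨θB, hθB⟩ := hB
  obtain ⟨r, q, hq1, hq2, hqc, -, -, heq, hcmp, -, hnear, -⟩ :=
    step_sup_structure up (fun t => -s t) b j d hup0 hup1 hlow
      ⟨-θA, sep_grefl up s b j (j + d) θA hθA⟩ ⟨-θB, sep_grefl up s b (j + 1) (j + d + 1) θB hθB⟩
      (fun θ h => by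
        have := hord (-θ) (-θ) (sep_of_grefl up s b j (j + d) θ h.1)
          (sep_of_grefl up s b (j + 1) (j + d + 1) θ h.2)
        exact lt_irrefl _ this)
      (fun θ θ' hθ hθ' => by
        have := hord (-θ) (-θ') (sep_of_grefl up s b j (j + d) θ hθ)
          (sep_of_grefl up s b (j + 1) (j + d + 1) θ' hθ')
        linarith)
  refine ⟨-r, fun m hm => ?_, fun e he1 he2 hec => ?_⟩
  · refine le_of_not_gt fun hcon => ?_
    obtain ⟨θ, hθ, hlt⟩ := hnear (m + r) (by linarith)
    have h1 := hm (-θ) (sep_of_grefl up s b j (j + d) θ hθ)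
    linarith
  · have h1 := hcmp e q he1 he2 (by omega) hq2 hec hqc
    have e1 : b q + -s q * r = b j + -s j * r := heq
    have e2 : b q + -s q * r ≤ b e + -s e * r := h1
    have r1 : s j * -r = -s j * r := by ring
    have r2 : s e * -r = -s e * r := by ring
    have r3 : s q * -r = -s q * r := by ring
    linarith

/-- Binding event of the (upper) ENTERING line `j+d+1`, row moving RIGHT, in lub form: at `A = inf T[j+1, j+d+1]`
the line `j+d+1` is the bottom upper line of `[j+1, j+d+1]`, and `A` is `≤` every strict upper bound of
`T[j+1, j+d+1]`. Obtained from `step_sup_structure` by the index swap `t ↦ (2j+d+1) - t` and `θ ↦ -θ`. -/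
theorem entering_event_right (up : ℕ → Prop) (s b : ℕ → ℝ) (j d : ℕ) (hup0 : up j) (hup1 : up (j + d + 1))
    (hlow : ∃ o : ℕ, j + 1 ≤ o ∧ o ≤ j + d ∧ ¬ up o)
    (hA : ∃ θ : ℝ, ∀ e o : ℕ, j ≤ e → e ≤ j + d → j ≤ o → o ≤ j + d → up e → ¬ up o →
      b o + s o * θ < b e + s e * θ)
    (hB : ∃ θ : ℝ, ∀ e o : ℕ, j + 1 ≤ e → e ≤ j + d + 1 → j + 1 ≤ o → o ≤ j + d + 1 → up e → ¬ up o →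
      b o + s o * θ < b e + s e * θ)
    (hord : ∀ θ θ' : ℝ, (∀ e o : ℕ, j ≤ e → e ≤ j + d → j ≤ o → o ≤ j + d → up e → ¬ up o →
      b o + s o * θ < b e + s e * θ) → (∀ e o : ℕ, j + 1 ≤ e → e ≤ j + d + 1 → j + 1 ≤ o → o ≤ j + d + 1 →
      up e → ¬ up o → b o + s o * θ' < b e + s e * θ') → θ < θ') :
    ∃ A : ℝ, (∀ M : ℝ, (∀ θ : ℝ, (∀ e o : ℕ, j + 1 ≤ e → e ≤ j + d + 1 → j + 1 ≤ o → o ≤ j + d + 1 → up e →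
      ¬ up o → b o + s o * θ < b e + s e * θ) → θ < M) → A ≤ M) ∧
      (∀ e : ℕ, j + 1 ≤ e → e ≤ j + d + 1 → up e → b (j + d + 1) + s (j + d + 1) * A ≤ b e + s e * A) := by
  obtain ⟨θA, hθA⟩ := hA
  obtain ⟨θB, hθB⟩ := hB
  obtain ⟨o1, ho1a, ho1b, ho1c⟩ := hlow
  obtain ⟨N, hN⟩ : ∃ N : ℕ, N = j + (j + d + 1) := ⟨_, rfl⟩
  have hNj : N - j = j + d + 1 := by omega
  have hNj' : N - (j + d + 1) = j := by omega
  have hNo : N - (N - o1) = o1 := by omega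
  obtain ⟨r, q, hq1, hq2, hqc, -, -, heq, hcmp, hTle, -, -⟩ :=
    step_sup_structure (fun t => up (N - t)) (fun t => -s (N - t)) (fun t => b (N - t)) j d
      (by show up (N - j); rw [hNj]; exact hup1) (by show up (N - (j + d + 1)); rw [hNj']; exact hup0)
      ⟨N - o1, by omega, by omega, by show ¬ up (N - (N - o1)); rw [hNo]; exact ho1c⟩
      ⟨-θB, sep_swaprefl up s b N (j + 1) (j + d + 1) j (j + d) (by omega) (by omega) θB hθB⟩
      ⟨-θA, sep_swaprefl up s b N j (j + d) (j + 1) (j + d + 1) (by omega) (by omega) θA hθA⟩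
      (fun θ h => by
        have := hord (-θ) (-θ) (sep_of_swaprefl up s b N j (j + d) (j + 1) (j + d + 1) (by omega) (by omega)
          θ h.2) (sep_of_swaprefl up s b N (j + 1) (j + d + 1) j (j + d) (by omega) (by omega) θ h.1)
        exact lt_irrefl _ this)
      (fun θ θ' hθ hθ' => by
        have := hord (-θ') (-θ) (sep_of_swaprefl up s b N j (j + d) (j + 1) (j + d + 1) (by omega)
          (by omega) θ' hθ') (sep_of_swaprefl up s b N (j + 1) (j + d + 1) j (j + d) (by omega) (by omega)
          θ hθ)
        linarith)
  refine ⟨-r, fun M hM => ?_, fun e he1 he2 hec => ?_⟩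
  · have h1 := hM θB hθB
    have h2 := hTle (-θB) (sep_swaprefl up s b N (j + 1) (j + d + 1) j (j + d) (by omega) (by omega) θB hθB)
    linarith
  · have hNe : N - (N - e) = e := by omega
    have h1 := hcmp (N - e) q (by omega) (by omega) (by omega) hq2 (by show up (N - (N - e)); rw [hNe]; exact hec)
      hqc
    have e1 : b (N - q) + -s (N - q) * r = b (N - j) + -s (N - j) * r := heq
    have e2 : b (N - q) + -s (N - q) * r ≤ b (N - (N - e)) + -s (N - (N - e)) * r := h1
    rw [hNe] at e2
    rw [hNj] at e1
    have r1 : s (j + d + 1) * -r = -s (j + d + 1) * r := by ring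
    have r2 : s e * -r = -s e * r := by ring
    have r3 : s (N - q) * -r = -s (N - q) * r := by ring
    linarith

/-- Binding event of the (upper) ENTERING line, row moving LEFT (`A = sup T[j+1, j+d+1]`), same conclusion; index
swap only. -/
theorem entering_event_left (up : ℕ → Prop) (s b : ℕ → ℝ) (j d : ℕ) (hup0 : up j) (hup1 : up (j + d + 1))
    (hlow : ∃ o : ℕ, j + 1 ≤ o ∧ o ≤ j + d ∧ ¬ up o)
    (hA : ∃ θ : ℝ, ∀ e o : ℕ, j ≤ e → e ≤ j + d → j ≤ o → o ≤ j + d → up e → ¬ up o →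
      b o + s o * θ < b e + s e * θ)
    (hB : ∃ θ : ℝ, ∀ e o : ℕ, j + 1 ≤ e → e ≤ j + d + 1 → j + 1 ≤ o → o ≤ j + d + 1 → up e → ¬ up o →
      b o + s o * θ < b e + s e * θ)
    (hord : ∀ θ θ' : ℝ, (∀ e o : ℕ, j ≤ e → e ≤ j + d → j ≤ o → o ≤ j + d → up e → ¬ up o →
      b o + s o * θ < b e + s e * θ) → (∀ e o : ℕ, j + 1 ≤ e → e ≤ j + d + 1 → j + 1 ≤ o → o ≤ j + d + 1 →
      up e → ¬ up o → b o + s o * θ' < b e + s e * θ') → θ' < θ) :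
    ∃ A : ℝ, (∀ M : ℝ, (∀ θ : ℝ, (∀ e o : ℕ, j + 1 ≤ e → e ≤ j + d + 1 → j + 1 ≤ o → o ≤ j + d + 1 → up e →
      ¬ up o → b o + s o * θ < b e + s e * θ) → θ < M) → A ≤ M) ∧
      (∀ e : ℕ, j + 1 ≤ e → e ≤ j + d + 1 → up e → b (j + d + 1) + s (j + d + 1) * A ≤ b e + s e * A) := by
  obtain ⟨θA, hθA⟩ := hA
  obtain ⟨θB, hθB⟩ := hB
  obtain ⟨o1, ho1a, ho1b, ho1c⟩ := hlow
  obtain ⟨N, hN⟩ : ∃ N : ℕ, N = j + (j + d + 1) := ⟨_, rfl⟩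
  have hNj : N - j = j + d + 1 := by omega
  have hNj' : N - (j + d + 1) = j := by omega
  have hNo : N - (N - o1) = o1 := by omega
  obtain ⟨r, q, hq1, hq2, hqc, -, -, heq, hcmp, -, hnear, -⟩ :=
    step_sup_structure (fun t => up (N - t)) (fun t => s (N - t)) (fun t => b (N - t)) j d
      (by show up (N - j); rw [hNj]; exact hup1) (by show up (N - (j + d + 1)); rw [hNj']; exact hup0)
      ⟨N - o1, by omega, by omega, by show ¬ up (N - (N - o1)); rw [hNo]; exact ho1c⟩
      ⟨θB, sep_swap up s b N (j + 1) (j + d + 1) j (j + d) (by omega) (by omega) θB hθB⟩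
      ⟨θA, sep_swap up s b N j (j + d) (j + 1) (j + d + 1) (by omega) (by omega) θA hθA⟩
      (fun θ h => by
        have := hord θ θ (sep_of_swap up s b N j (j + d) (j + 1) (j + d + 1) (by omega) (by omega) θ h.2)
          (sep_of_swap up s b N (j + 1) (j + d + 1) j (j + d) (by omega) (by omega) θ h.1)
        exact lt_irrefl _ this)
      (fun θ θ' hθ hθ' => hord θ' θ (sep_of_swap up s b N j (j + d) (j + 1) (j + d + 1) (by omega) (by omega)
        θ' hθ') (sep_of_swap up s b N (j + 1) (j + d + 1) j (j + d) (by omega) (by omega) θ hθ))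
  refine ⟨r, fun M hM => ?_, fun e he1 he2 hec => ?_⟩
  · refine le_of_not_gt fun hcon => ?_
    obtain ⟨θ, hθ, hlt⟩ := hnear (r - M) (by linarith)
    have h1 := hM θ (sep_of_swap up s b N (j + 1) (j + d + 1) j (j + d) (by omega) (by omega) θ hθ)
    linarith
  · have hNe : N - (N - e) = e := by omega
    have h1 := hcmp (N - e) q (by omega) (by omega) (by omega) hq2 (by show up (N - (N - e)); rw [hNe]; exact hec)
      hqc
    have e1 : b (N - q) + s (N - q) * r = b (N - j) + s (N - j) * r := heq
    have e2 : b (N - q) + s (N - q) * r ≤ b (N - (N - e)) + s (N - (N - e)) * r := h1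
    rw [hNe] at e2
    rw [hNj] at e1
    linarith

/-- FIVE-ROW SIGN LAW, abstract core: four predicates `T1 < T2 < T3 < T4` (pointwise, `T2`, `T3` inhabited), a point
`A` below every strict upper bound of `T1` with `S_y(A) ≤ S_x(A)`, a point `B` above every strict lower bound of
`T4` with `S_x(B) ≤ S_y(B)`; then `s y < s x` is impossible. -/
theorem five_row_core (s b : ℕ → ℝ) (x y : ℕ) (T1 T2 T3 T4 : ℝ → Prop)
    (hord1 : ∀ θ θ' : ℝ, T1 θ → T2 θ' → θ < θ') (hA2 : ∃ θ : ℝ, T2 θ)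
    (hord2 : ∀ θ θ' : ℝ, T2 θ → T3 θ' → θ < θ') (hA3 : ∃ θ : ℝ, T3 θ)
    (hord3 : ∀ θ θ' : ℝ, T3 θ → T4 θ' → θ < θ')
    (hAev : ∃ A : ℝ, (∀ M : ℝ, (∀ θ : ℝ, T1 θ → θ < M) → A ≤ M) ∧ b y + s y * A ≤ b x + s x * A)
    (hBev : ∃ B : ℝ, (∀ m : ℝ, (∀ θ : ℝ, T4 θ → m < θ) → m ≤ B) ∧ b x + s x * B ≤ b y + s y * B)
    (hV : s y < s x) : False := by
  obtain ⟨θ2, hθ2⟩ := hA2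
  obtain ⟨θ3, hθ3⟩ := hA3
  obtain ⟨A, hAle, hu⟩ := hAev
  obtain ⟨B, hBge, hv⟩ := hBev
  have h1 : A ≤ θ2 := hAle θ2 (fun θ hθ => hord1 θ θ2 hθ hθ2)
  have h2 : θ2 < θ3 := hord2 θ2 θ3 hθ2 hθ3
  have h3 : θ3 ≤ B := hBge θ3 (fun θ hθ => hord3 θ3 θ hθ3 hθ)
  exact two_point_sign s b x y A B (by linarith) hu hv hV

end Summit.ValiantsHypothesis.ValiantsHypothesis.Theorems.KPlusLogSqLawStepEvents
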